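import Mathlib
import Summits.Ventures.HodgeRepro.Tier3PadicExpLimit

/-!
# Tier 3 (T3.2 / T3.5) — Serre's Proposition 8, the passage to the limit, II: the inverse
`padicLog`, continuity, and `(ℤ_p, +) ≃* 1 + pℤ_p` (`p` odd)

Companion of `Tier3PadicExpLimit` (which constructs `padicExp a = lim (1 + p) ^ (appr a n)`, proves
it is a homomorphism `(ℤ_p, +) → (ℤ_p, ·)` with values in `1 + pℤ_p`, and injective). Here:

* SURJECTIVE (`exists_padicExp_eq`): for `u ≡ 1 (mod p)` the landed finite-level cyclicity
  (`exists_pow_one_add_prime_dvd_sub_lt`) gives `kₙ < pⁿ` with `u ≡ (1 + p) ^ kₙ (mod p ^ (n+1))`;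
  the EXACT order of `1 + p` in `U_1/U_{n+1}` (`int_dvd_of_pow_sub_pow_mem_span`, from lifting the
  exponent) makes `(kₙ)` Cauchy in `ℤ_p`; its limit `padicLog u` satisfies
  `padicExp (padicLog u) = u` (`padicExp_padicLog`);
* CONTINUITY (`continuous_padicExp`): `a ≡ b (mod pⁿ) ⇒ padicExp a ≡ padicExp b (mod p ^ (n+1))`
  (`padicExp_sub_padicExp_mem_span`);
* PACKAGING: `principalUnits p : Subgroup ℤ_[p]ˣ` (`U_1 = 1 + pℤ_p`), `padicExpHom`, and
  **Serre, Proposition 8 (p ≠ 2)** as `padicExpEquiv : Multiplicative ℤ_[p] ≃* principalUnits p`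
  (`MulEquiv.ofBijective`), with `coe_padicExpEquiv_apply`; and its TOPOLOGICAL form
  `padicExpHomeomorph : ℤ_[p] ≃ₜ principalUnits p` (`ℤ_p` compact, the target Hausdorff, so the
  inverse `padicLog` is continuous too). Tightness at `p = 2` is the landed
  `two_dvd_neg_one_sub_one_and_neg_one_sq_eq_one_and_neg_one_ne_one` (`−1 ∈ 1 + 2ℤ_2` is torsion).

Imports: Mathlib + the cell's `Tier3PadicExpLimit` (hence `Tier3PadicPrincipalUnits`) only;
definitions: `approxExp`, `padicLog`, `principalUnits`, `padicExpUnit`, `padicExpHom`,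
`padicExpEquiv`, `padicExpEquivPlain`, `padicExpHomeomorph`; no instance; no axiom beyond the
standard three.
-/

namespace Summit.Ventures.HodgeRepro.T3.PadicExpLimit

open Summit.Ventures.HodgeRepro.T3.PadicPrincipalUnits Filter Topology

section Surjective

variable (p : ℕ) [hp : Fact p.Prime]

/-- The exact order of `1 + p` in `U_1/U_{n+1}`: if `(1 + p) ^ k ≡ (1 + p) ^ l (mod p ^ (n+1))`
then `pⁿ ∣ k − l` (in `ℤ`). -/
theorem int_dvd_of_pow_sub_pow_mem_span (hp1 : Odd p) {k l n : ℕ}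
    (h : (1 + p : ℤ_[p]) ^ k - (1 + p : ℤ_[p]) ^ l ∈ Ideal.span {(p : ℤ_[p]) ^ (n + 1)}) :
    (p : ℤ) ^ n ∣ (k : ℤ) - l := by
  -- reduce to `l ≤ k` by symmetry
  suffices H : ∀ k l : ℕ, l ≤ k →
      (1 + p : ℤ_[p]) ^ k - (1 + p : ℤ_[p]) ^ l ∈ Ideal.span {(p : ℤ_[p]) ^ (n + 1)} →
      (p : ℤ) ^ n ∣ (k : ℤ) - l by
    rcases le_total l k with hlk | hkl
    · exact H k l hlk h
    · have h' := neg_mem h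
      rw [neg_sub] at h'
      have := H l k hkl h'
      rw [← neg_sub]
      exact (dvd_neg).mpr this
  intro k l hlk h
  -- (1+p)^k - (1+p)^l = (1+p)^l * ((1+p)^(k-l) - 1), and (1+p)^l is a unit
  set d := k - l with hd
  have hk : k = d + l := by omega
  have hunit : IsUnit ((1 + p : ℤ_[p]) ^ l) :=
    (isUnit_of_not_dvd p (not_dvd_of_dvd_sub_one p (dvd_one_add_prime_sub_one p))).pow l
  have h2 : (1 + p : ℤ_[p]) ^ d - 1 ∈ Ideal.span {(p : ℤ_[p]) ^ (n + 1)} := by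
    rw [hk, pow_add (1 + (p : ℤ_[p])) d l, ← sub_one_mul] at h
    rw [Ideal.mem_span_singleton] at h ⊢
    exact (hunit.dvd_mul_right).mp h
  -- divisibility of `k - l` in `ℕ` then in `ℤ`
  suffices hnat : p ^ n ∣ d by
    have h' : ((p ^ n : ℕ) : ℤ) ∣ ((k - l : ℕ) : ℤ) := Int.natCast_dvd_natCast.mpr hnat
    rw [Nat.cast_sub hlk, Nat.cast_pow] at h'
    exact h'
  rcases Nat.eq_zero_or_pos d with hd0 | hdpos
  · rw [hd0]
    exact dvd_zero _
  have hfin : FiniteMultiplicity p d := Nat.finiteMultiplicity_iff.mpr ⟨hp.out.ne_one, hdpos⟩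
  have hv := emultiplicity_pow_sub_pow p hp1 (dvd_one_add_prime_sub_one p)
    (not_dvd_of_dvd_sub_one p (dvd_one_add_prime_sub_one p)) d
  rw [one_pow, emultiplicity_one_add_prime_sub_one p, hfin.emultiplicity_eq_multiplicity] at hv
  rw [Ideal.mem_span_singleton] at h2
  have hle := le_emultiplicity_of_pow_dvd h2
  rw [hv] at hle
  have hle' : n + 1 ≤ 1 + multiplicity p d := by exact_mod_cast hle
  exact dvd_trans (pow_dvd_pow p (by omega)) (pow_multiplicity_dvd p d)

/-- The approximating exponents of a principal unit `u`: `kₙ < pⁿ` with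
`u ≡ (1 + p) ^ kₙ (mod p ^ (n+1))` (the landed finite-level cyclicity). -/
noncomputable def approxExp (hp1 : Odd p) {u : ℤ_[p]} (hu : (p : ℤ_[p]) ∣ u - 1) (n : ℕ) : ℕ :=
  Classical.choose (exists_pow_one_add_prime_dvd_sub_lt p hp1 hu n)

/-- `u ≡ (1 + p) ^ (approxExp u n) (mod p ^ (n+1))`. -/
theorem sub_pow_approxExp_mem_span (hp1 : Odd p) {u : ℤ_[p]} (hu : (p : ℤ_[p]) ∣ u - 1)
    (n : ℕ) : u - (1 + p : ℤ_[p]) ^ (approxExp p hp1 hu n) ∈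
      Ideal.span {(p : ℤ_[p]) ^ (n + 1)} := by
  rw [Ideal.mem_span_singleton]
  exact (Classical.choose_spec (exists_pow_one_add_prime_dvd_sub_lt p hp1 hu n)).2

/-- The exponents are compatible: `pⁿ ∣ approxExp u m − approxExp u n` for `n ≤ m`. -/
theorem int_dvd_approxExp_sub (hp1 : Odd p) {u : ℤ_[p]} (hu : (p : ℤ_[p]) ∣ u - 1) {m n : ℕ}
    (hnm : n ≤ m) :
    (p : ℤ) ^ n ∣ (approxExp p hp1 hu m : ℤ) - approxExp p hp1 hu n := by
  apply int_dvd_of_pow_sub_pow_mem_span p hp1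
  have h1 := sub_pow_approxExp_mem_span p hp1 hu n
  have h2 := span_pow_le_span_pow p (by omega : n + 1 ≤ m + 1)
    (sub_pow_approxExp_mem_span p hp1 hu m)
  have : (1 + p : ℤ_[p]) ^ (approxExp p hp1 hu m) - (1 + p : ℤ_[p]) ^ (approxExp p hp1 hu n) =
      (u - (1 + p : ℤ_[p]) ^ (approxExp p hp1 hu n)) -
        (u - (1 + p : ℤ_[p]) ^ (approxExp p hp1 hu m)) := by ring
  rw [this]
  exact Ideal.sub_mem _ h1 h2

/-- `(approxExp u m : ℤ_p) ≡ approxExp u n (mod pⁿ)` for `n ≤ m`. -/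
theorem approxExp_sub_mem_span (hp1 : Odd p) {u : ℤ_[p]} (hu : (p : ℤ_[p]) ∣ u - 1) {m n : ℕ}
    (hnm : n ≤ m) :
    ((approxExp p hp1 hu m : ℕ) : ℤ_[p]) - ((approxExp p hp1 hu n : ℕ) : ℤ_[p]) ∈
      Ideal.span {(p : ℤ_[p]) ^ n} := by
  rw [← PadicInt.norm_le_pow_iff_mem_span_pow]
  have h := PadicInt.norm_int_le_pow_iff_dvd.mpr (int_dvd_approxExp_sub p hp1 hu hnm)
  push_cast at h
  exact h

/-- The exponents form a Cauchy sequence in `ℤ_p`. -/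
theorem cauchySeq_approxExp (hp1 : Odd p) {u : ℤ_[p]} (hu : (p : ℤ_[p]) ∣ u - 1) :
    CauchySeq (fun n => ((approxExp p hp1 hu n : ℕ) : ℤ_[p])) := by
  refine cauchySeq_of_le_tendsto_0 (fun N : ℕ => (p : ℝ) ^ (-(N : ℤ)))
    (fun n m N hNn hNm => ?_) (tendsto_pow_neg p)
  have h1 : (1 : ℝ) ≤ p := by exact_mod_cast hp.out.one_lt.le
  rcases le_total n m with hnm | hmn
  · calc dist ((approxExp p hp1 hu n : ℕ) : ℤ_[p]) ((approxExp p hp1 hu m : ℕ) : ℤ_[p])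
        = ‖((approxExp p hp1 hu m : ℕ) : ℤ_[p]) - ((approxExp p hp1 hu n : ℕ) : ℤ_[p])‖ := by
          rw [dist_comm, dist_eq_norm]
      _ ≤ (p : ℝ) ^ (-(n : ℤ)) := norm_le_of_mem_span p (approxExp_sub_mem_span p hp1 hu hnm)
      _ ≤ (p : ℝ) ^ (-(N : ℤ)) := zpow_le_zpow_right₀ h1 (by omega)
  · calc dist ((approxExp p hp1 hu n : ℕ) : ℤ_[p]) ((approxExp p hp1 hu m : ℕ) : ℤ_[p])
        = ‖((approxExp p hp1 hu n : ℕ) : ℤ_[p]) - ((approxExp p hp1 hu m : ℕ) : ℤ_[p])‖ := by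
          rw [dist_eq_norm]
      _ ≤ (p : ℝ) ^ (-(m : ℤ)) := norm_le_of_mem_span p (approxExp_sub_mem_span p hp1 hu hmn)
      _ ≤ (p : ℝ) ^ (-(N : ℤ)) := zpow_le_zpow_right₀ h1 (by omega)

/-- The `p`-adic limit of the exponents: the «logarithm» of `u` to the base `1 + p`. -/
noncomputable def padicLog (hp1 : Odd p) {u : ℤ_[p]} (hu : (p : ℤ_[p]) ∣ u - 1) : ℤ_[p] :=
  limUnder atTop (fun n => ((approxExp p hp1 hu n : ℕ) : ℤ_[p]))

/-- The exponents converge to `padicLog u`. -/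
theorem tendsto_approxExp (hp1 : Odd p) {u : ℤ_[p]} (hu : (p : ℤ_[p]) ∣ u - 1) :
    Tendsto (fun n => ((approxExp p hp1 hu n : ℕ) : ℤ_[p])) atTop (𝓝 (padicLog p hp1 hu)) :=
  (cauchySeq_approxExp p hp1 hu).tendsto_limUnder

/-- `padicLog u ≡ approxExp u n (mod pⁿ)`. -/
theorem padicLog_sub_approxExp_mem_span (hp1 : Odd p) {u : ℤ_[p]} (hu : (p : ℤ_[p]) ∣ u - 1)
    (n : ℕ) : padicLog p hp1 hu - ((approxExp p hp1 hu n : ℕ) : ℤ_[p]) ∈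
      Ideal.span {(p : ℤ_[p]) ^ n} :=
  (isClosed_sub_mem_span p _ n).mem_of_tendsto (tendsto_approxExp p hp1 hu)
    (eventually_atTop.mpr ⟨n, fun _ hm => approxExp_sub_mem_span p hp1 hu hm⟩)

/-- `approxPow (padicLog u) n ≡ u (mod p ^ (n+1))`. -/
theorem approxPow_padicLog_sub_mem_span (hp1 : Odd p) {u : ℤ_[p]} (hu : (p : ℤ_[p]) ∣ u - 1)
    (n : ℕ) : approxPow p (padicLog p hp1 hu) n - u ∈ Ideal.span {(p : ℤ_[p]) ^ (n + 1)} := by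
  -- appr (padicLog u) n ≡ padicLog u ≡ approxExp u n (mod pⁿ)
  have h1 : (p : ℤ) ^ n ∣ ((padicLog p hp1 hu).appr n : ℤ) - approxExp p hp1 hu n := by
    apply int_dvd_of_sub_mem_span p
    have ha := PadicInt.appr_spec n (padicLog p hp1 hu)
    have hb := padicLog_sub_approxExp_mem_span p hp1 hu n
    have : (((padicLog p hp1 hu).appr n : ℕ) : ℤ_[p]) - ((approxExp p hp1 hu n : ℕ) : ℤ_[p]) =
        (padicLog p hp1 hu - ((approxExp p hp1 hu n : ℕ) : ℤ_[p])) -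
          (padicLog p hp1 hu - (padicLog p hp1 hu).appr n) := by ring
    rw [this]
    exact Ideal.sub_mem _ hb ha
  have h2 := pow_sub_pow_mem_span_of_int_dvd p hp1 h1
  have h3 := sub_pow_approxExp_mem_span p hp1 hu n
  have : approxPow p (padicLog p hp1 hu) n - u =
      ((1 + p : ℤ_[p]) ^ ((padicLog p hp1 hu).appr n) -
        (1 + p : ℤ_[p]) ^ (approxExp p hp1 hu n)) -
        (u - (1 + p : ℤ_[p]) ^ (approxExp p hp1 hu n)) := by
    unfold approxPow
    ring
  rw [this]
  exact Ideal.sub_mem _ h2 h3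

/-- `padicExp (padicLog u) = u`: every principal unit is a value. -/
theorem padicExp_padicLog (hp1 : Odd p) {u : ℤ_[p]} (hu : (p : ℤ_[p]) ∣ u - 1) :
    padicExp p (padicLog p hp1 hu) = u := by
  have h : Tendsto (approxPow p (padicLog p hp1 hu)) atTop (𝓝 u) := by
    refine tendsto_const_nhds.congr_dist (squeeze_zero (fun n => dist_nonneg) (fun n => ?_)
      (tendsto_pow_neg_succ p))
    rw [dist_comm, dist_eq_norm]
    exact norm_le_of_mem_span p (approxPow_padicLog_sub_mem_span p hp1 hu n)
  exact tendsto_nhds_unique (tendsto_approxPow p hp1 _) h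

/-- Surjectivity onto the principal units. -/
theorem exists_padicExp_eq (hp1 : Odd p) {u : ℤ_[p]} (hu : (p : ℤ_[p]) ∣ u - 1) :
    ∃ a : ℤ_[p], padicExp p a = u :=
  ⟨padicLog p hp1 hu, padicExp_padicLog p hp1 hu⟩

end Surjective

section Continuity

variable (p : ℕ) [hp : Fact p.Prime]

/-- `a ≡ b (mod pⁿ) ⇒ padicExp a ≡ padicExp b (mod p ^ (n+1))`. -/
theorem padicExp_sub_padicExp_mem_span (hp1 : Odd p) {a b : ℤ_[p]} {n : ℕ}
    (h : a - b ∈ Ideal.span {(p : ℤ_[p]) ^ n}) :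
    padicExp p a - padicExp p b ∈ Ideal.span {(p : ℤ_[p]) ^ (n + 1)} := by
  have h1 : (p : ℤ) ^ n ∣ (a.appr n : ℤ) - b.appr n := by
    apply int_dvd_of_sub_mem_span p
    have ha := PadicInt.appr_spec n a
    have hb := PadicInt.appr_spec n b
    have : ((a.appr n : ℕ) : ℤ_[p]) - ((b.appr n : ℕ) : ℤ_[p]) =
        (b - b.appr n) - (a - a.appr n) + (a - b) := by ring
    rw [this]
    exact Ideal.add_mem _ (Ideal.sub_mem _ hb ha) h
  have h2 : approxPow p a n - approxPow p b n ∈ Ideal.span {(p : ℤ_[p]) ^ (n + 1)} :=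
    pow_sub_pow_mem_span_of_int_dvd p hp1 h1
  have h3 := padicExp_sub_approxPow_mem_span p hp1 a n
  have h4 := padicExp_sub_approxPow_mem_span p hp1 b n
  have : padicExp p a - padicExp p b =
      (padicExp p a - approxPow p a n) + (approxPow p a n - approxPow p b n) -
        (padicExp p b - approxPow p b n) := by ring
  rw [this]
  exact Ideal.sub_mem _ (Ideal.add_mem _ h3 h2) h4

/-- `padicExp` is continuous (indeed `‖padicExp a − padicExp b‖ ≤ p⁻¹ ‖a − b‖`). -/
theorem continuous_padicExp (hp1 : Odd p) : Continuous (padicExp p) := by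
  rw [Metric.continuous_iff]
  intro b ε hε
  obtain ⟨n, hn⟩ := PadicInt.exists_pow_neg_lt p hε
  refine ⟨(p : ℝ) ^ (-(n : ℤ)), zpow_pos (by exact_mod_cast hp.out.pos) _, fun a hab => ?_⟩
  have h1 : a - b ∈ Ideal.span {(p : ℤ_[p]) ^ n} := by
    rw [← PadicInt.norm_le_pow_iff_mem_span_pow, ← dist_eq_norm]
    exact hab.le
  have h2 := norm_le_of_mem_span p (padicExp_sub_padicExp_mem_span p hp1 h1)
  have hp1' : (1 : ℝ) ≤ p := by exact_mod_cast hp.out.one_lt.le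
  calc dist (padicExp p a) (padicExp p b) = ‖padicExp p a - padicExp p b‖ := dist_eq_norm _ _
    _ ≤ (p : ℝ) ^ (-((n + 1 : ℕ) : ℤ)) := h2
    _ ≤ (p : ℝ) ^ (-(n : ℤ)) := zpow_le_zpow_right₀ hp1' (by omega)
    _ < ε := hn

end Continuity

section Packaging

variable (p : ℕ) [hp : Fact p.Prime]

/-- The principal units `U_1 = 1 + pℤ_p` as a subgroup of `ℤ_[p]ˣ`. -/
def principalUnits : Subgroup ℤ_[p]ˣ where
  carrier := {u | (p : ℤ_[p]) ∣ (u : ℤ_[p]) - 1}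
  one_mem' := by simp
  mul_mem' := by
    intro u v hu hv
    have : ((u * v : ℤ_[p]ˣ) : ℤ_[p]) - 1 = (u : ℤ_[p]) * ((v : ℤ_[p]) - 1) + ((u : ℤ_[p]) - 1) := by
      push_cast
      ring
    simp only [Set.mem_setOf_eq] at hu hv ⊢
    rw [this]
    exact dvd_add (dvd_mul_of_dvd_right hv _) hu
  inv_mem' := by
    intro u hu
    simp only [Set.mem_setOf_eq] at hu ⊢
    have : ((u⁻¹ : ℤ_[p]ˣ) : ℤ_[p]) - 1 = -(((u⁻¹ : ℤ_[p]ˣ) : ℤ_[p]) * ((u : ℤ_[p]) - 1)) := by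
      rw [mul_sub, Units.inv_mul, mul_one, neg_sub]
    rw [this]
    exact (dvd_neg).mpr (dvd_mul_of_dvd_right hu _)

/-- Membership in `principalUnits`. -/
theorem mem_principalUnits {u : ℤ_[p]ˣ} :
    u ∈ principalUnits p ↔ (p : ℤ_[p]) ∣ (u : ℤ_[p]) - 1 := Iff.rfl

/-- `padicExp a` as a principal unit. -/
noncomputable def padicExpUnit (hp1 : Odd p) (a : ℤ_[p]) : principalUnits p :=
  ⟨(isUnit_padicExp p hp1 a).unit, by
    rw [mem_principalUnits, IsUnit.unit_spec]
    exact dvd_padicExp_sub_one p hp1 a⟩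

/-- The underlying element of `padicExpUnit a` is `padicExp a`. -/
@[simp] theorem coe_padicExpUnit (hp1 : Odd p) (a : ℤ_[p]) :
    ((padicExpUnit p hp1 a : ℤ_[p]ˣ) : ℤ_[p]) = padicExp p a :=
  IsUnit.unit_spec _

/-- `padicExp` as a group homomorphism `(ℤ_p, +) → U_1`. -/
noncomputable def padicExpHom (hp1 : Odd p) : Multiplicative ℤ_[p] →* principalUnits p where
  toFun a := padicExpUnit p hp1 (Multiplicative.toAdd a)
  map_one' := by
    apply Subtype.ext
    apply Units.ext
    rw [coe_padicExpUnit]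
    simp only [toAdd_one, padicExp_zero p hp1, OneMemClass.coe_one, Units.val_one]
  map_mul' a b := by
    apply Subtype.ext
    apply Units.ext
    rw [coe_padicExpUnit, toAdd_mul, padicExp_add p hp1]
    simp only [Subgroup.coe_mul, Units.val_mul, coe_padicExpUnit]

/-- `padicExpHom` is injective. -/
theorem padicExpHom_injective (hp1 : Odd p) : Function.Injective (padicExpHom p hp1) := by
  intro a b hab
  have h := congrArg (fun x : principalUnits p => ((x : ℤ_[p]ˣ) : ℤ_[p])) hab
  simp only [padicExpHom, MonoidHom.coe_mk, OneHom.coe_mk, coe_padicExpUnit] at h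
  exact padicExp_injective p hp1 h

/-- `padicExpHom` is surjective. -/
theorem padicExpHom_surjective (hp1 : Odd p) : Function.Surjective (padicExpHom p hp1) := by
  intro u
  obtain ⟨a, ha⟩ := exists_padicExp_eq p hp1 ((mem_principalUnits p).mp u.2)
  refine ⟨Multiplicative.ofAdd a, ?_⟩
  apply Subtype.ext
  apply Units.ext
  simp only [padicExpHom, MonoidHom.coe_mk, OneHom.coe_mk, toAdd_ofAdd, coe_padicExpUnit]
  exact ha

/-- **Serre, Proposition 8 (p ≠ 2)**: `(ℤ_p, +) ≅ U_1 = 1 + pℤ_p` as groups, by `a ↦ (1 + p)^a`. -/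
noncomputable def padicExpEquiv (hp1 : Odd p) : Multiplicative ℤ_[p] ≃* principalUnits p :=
  MulEquiv.ofBijective (padicExpHom p hp1) ⟨padicExpHom_injective p hp1, padicExpHom_surjective p hp1⟩

/-- The equivalence is `padicExp` on underlying elements. -/
theorem coe_padicExpEquiv_apply (hp1 : Odd p) (a : ℤ_[p]) :
    ((padicExpEquiv p hp1 (Multiplicative.ofAdd a) : ℤ_[p]ˣ) : ℤ_[p]) = padicExp p a := by
  simp only [padicExpEquiv, MulEquiv.ofBijective_apply, padicExpHom, MonoidHom.coe_mk,
    OneHom.coe_mk, toAdd_ofAdd, coe_padicExpUnit]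

end Packaging

section Homeomorphism

variable (p : ℕ) [hp : Fact p.Prime]

/-- `padicExp (−a)` is the inverse of `padicExp a`. -/
theorem padicExp_neg_mul (hp1 : Odd p) (a : ℤ_[p]) : padicExp p (-a) * padicExp p a = 1 := by
  rw [← padicExp_add p hp1, neg_add_cancel, padicExp_zero p hp1]

/-- The inverse of the unit `padicExpUnit a` has value `padicExp (−a)`. -/
theorem coe_padicExpUnit_inv (hp1 : Odd p) (a : ℤ_[p]) :
    (((padicExpUnit p hp1 a : ℤ_[p]ˣ)⁻¹ : ℤ_[p]ˣ) : ℤ_[p]) = padicExp p (-a) := by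
  apply Units.inv_eq_of_mul_eq_one_right
  rw [coe_padicExpUnit, mul_comm]
  exact padicExp_neg_mul p hp1 a

/-- `a ↦ padicExpUnit a` is continuous into `ℤ_[p]ˣ` (value and inverse both continuous). -/
theorem continuous_padicExpUnit_units (hp1 : Odd p) :
    Continuous (fun a : ℤ_[p] => (padicExpUnit p hp1 a : ℤ_[p]ˣ)) := by
  rw [Units.continuous_iff]
  constructor
  · have : (Units.val ∘ fun a : ℤ_[p] => (padicExpUnit p hp1 a : ℤ_[p]ˣ)) = padicExp p := by
      funext a
      exact coe_padicExpUnit p hp1 a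
    rw [this]
    exact continuous_padicExp p hp1
  · have : (fun a : ℤ_[p] => (((padicExpUnit p hp1 a : ℤ_[p]ˣ)⁻¹ : ℤ_[p]ˣ) : ℤ_[p])) =
        fun a => padicExp p (-a) := by
      funext a
      exact coe_padicExpUnit_inv p hp1 a
    rw [this]
    exact (continuous_padicExp p hp1).comp continuous_neg

/-- … and into the subgroup `principalUnits p`. -/
theorem continuous_padicExpUnit (hp1 : Odd p) : Continuous (padicExpUnit p hp1) :=
  (continuous_padicExpUnit_units p hp1).subtype_mk _

/-- The bijection `ℤ_p ≃ U_1` underlying `padicExpEquiv`, on the plain types. -/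
noncomputable def padicExpEquivPlain (hp1 : Odd p) : ℤ_[p] ≃ principalUnits p :=
  Multiplicative.ofAdd.trans (padicExpEquiv p hp1).toEquiv

/-- It is `padicExpUnit` pointwise. -/
theorem padicExpEquivPlain_apply (hp1 : Odd p) (a : ℤ_[p]) :
    padicExpEquivPlain p hp1 a = padicExpUnit p hp1 a := rfl

/-- **Serre, Proposition 8 (p ≠ 2), topological form**: `ℤ_p ≃ₜ U_1` — the continuous bijection
`a ↦ (1 + p)^a` from the compact `ℤ_p` onto the Hausdorff `U_1 ⊂ ℤ_[p]ˣ` is a homeomorphism, so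
its inverse (the «logarithm» `padicLog`) is continuous as well. -/
noncomputable def padicExpHomeomorph (hp1 : Odd p) : ℤ_[p] ≃ₜ principalUnits p :=
  Continuous.homeoOfEquivCompactToT2 (f := padicExpEquivPlain p hp1) (by
    have : ⇑(padicExpEquivPlain p hp1) = padicExpUnit p hp1 :=
      funext (padicExpEquivPlain_apply p hp1)
    rw [this]
    exact continuous_padicExpUnit p hp1)

end Homeomorphism

end Summit.Ventures.HodgeRepro.T3.PadicExpLimit
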